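import Literature.AnabelianGeometry.AbsoluteAnabelian.AbsTopII.EllipticCuspidalizationCanonical
import HarnessLib

/-!
# [AbsTopII] Ex 3.2 (i): the datum-side and the chain-side readings of the `[N]`-covering subgroup agree

S. Mochizuki, *Topics in Absolute Anabelian Geometry II* [AbsTopII] (bib `MochizukiAbsTopII2013`;
kurims manuscript `paper:url-585b8d0ad0d9`, render p0066), Example 3.2 (i) p. 66; [AbsTopI] Lem 4.5 (vi)
p. 55 ("`I = C_Π(I ∩ Δ)`": a cusp's decomposition group is the commensurator of its inertia group).

PROOF-ONLY bridge (no definition), abc-iut cell row «COR34-DATUM» (seat abc-iut-L4-t4 gen 7), announced in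
the v2 module docstring of `AbsTopII/EllipticCuspidalizationCanonical.lean` (p444546: "a later bridge «under
a cusp-respecting identification the two agree»"): the two typings of the `[N]_D`-covering subgroup
`Π_U = (Π_D ↠ Π_E)⁻¹(N·Δ_E · D_O)` —

* the DATUM-side `CuspidalData.torsionCoveringSubgroup CD x N = closure (K_x ⊔ ⟨Δ^N⟩ ⊔ D_x)`
  (`EllipticTorsionCovering.lean`, p442930: decomposition group `D_x` given by the cuspidal data), and
* the CHAIN-side `ChainGroup.torsionCovering L C N = closure (K_C ⊔ ⟨Δ_L^N⟩ ⊔ C_{Π_L}(C))`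
  (p444546, abc-iut-L4-t6's intrinsic form: `C` a (3_Π) cuspidal group in `Δ_L`, decomposition group
  recovered as its commensurator) —

COINCIDE on the initial chain term `Π₀ = Π` (`ChainGroup.self`) at `C := I_x`, as soon as the cusp's
decomposition group IS the commensurator of its inertia group ([AbsTopI] Lem 4.5 (vi), a hypothesis
here: `Subgroup.Commensurable.commensurator (I_x) = D_x`).  HONEST FRAMING: elementary; typed ≠ proved for
anything in print; nothing here bears on [IUTchIII] Cor 3.12.
-/

noncomputable section

open Topology
open scoped Pointwise

universe u

namespace Literature.AnabelianGeometry.AbsoluteAnabelian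

open Literature.AlgebraicGeometry.Frobenioids (IsSlimGroup)

namespace FundamentalExtension

variable {E : FundamentalExtension.{u}}

/-- On the initial term `Π₀ = Π` of every `Π`-chain, `Δ₀ = Ker(Π → G) = Δ`.
[cite: MochizukiAbsTopI2012, Def 4.2 (iii) p.49] -/
theorem ChainGroup.geomJ_self (hP : IsSlimGroup E.arith) (hΔ : IsSlimGroup E.geom) (hne : E.geom ≠ ⊥) :
    (ChainGroup.self hP hΔ hne).geomJ = E.geom := rfl

/-- **The datum-side and chain-side `[N]`-covering subgroups agree on `Π₀ = Π`**: for a cusp `x` whose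
decomposition group is the commensurator of its inertia group ([AbsTopI] Lem 4.5 (vi)),
`torsionCovering (Π₀) (I_x) N = torsionCoveringSubgroup x N`.
[cite: MochizukiAbsTopII2013, Ex 3.2 (i) p.66] -/
theorem CuspidalData.torsionCovering_self_Icusp (CD : CuspidalData E) (hP : IsSlimGroup E.arith)
    (hΔ : IsSlimGroup E.geom) (hne : E.geom ≠ ⊥) (x : CD.Cusp) (N : ℕ)
    (hcomm : Subgroup.Commensurable.commensurator (CD.Icusp x) = CD.Dcusp x) :
    (ChainGroup.self hP hΔ hne).torsionCovering (CD.Icusp x) N = CD.torsionCoveringSubgroup x N := by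
  show ((Subgroup.normalClosure (CD.Icusp x : Set E.arith)).topologicalClosure ⊔
      Subgroup.closure ((fun δ : E.arith => δ ^ N) '' (E.geom : Set E.arith)) ⊔
      Subgroup.Commensurable.commensurator (CD.Icusp x)).topologicalClosure =
    ((Subgroup.normalClosure (CD.Icusp x : Set E.arith)).topologicalClosure ⊔
      Subgroup.closure ((fun δ : E.arith => δ ^ N) '' (E.geom : Set E.arith)) ⊔
      CD.Dcusp x).topologicalClosure
  rw [hcomm]

end FundamentalExtension

end Literature.AnabelianGeometry.AbsoluteAnabelian

end
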